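import Literature.MathematicalPhysics.QuantumFieldTheory.Balaban1983to89.B5SupWalk131
import Literature.MathematicalPhysics.QuantumFieldTheory.Balaban1983to89.B5FromB4

/-!
# `Balaban1983to89.B5SupWalkS1` — Bałaban CMP 95 (1984), Proposition 1.2: the slot S1 of
# `B5.prop12_of_printed_steps` («(1.115)–(1.117), (1.89) imply the proposition») DISCHARGED by the walk machines —
# the sup/Hölder realisation (dictionary of one instance to `B5SupWalk125`/`B5SupWalk131`) and its family theorem

statement-level skeleton of published theorems with citation tags; proofs where landed; nothing here is a claim
about the Yang–Mills mass gap

Source (lit-balaban cell, reader/typer r02 gen 10 = owner of block B5; file 3 of the «STEP S1 AS PRINTED» programme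
of the Phase-2 proof seat p37 gen 8, whose files 1–2 are `B5SupWalk125` / `B5SupWalk131`): T. Bałaban, *Propagators and
renormalization transformations for lattice gauge theories. I*, Commun. Math. Phys. **95** (1984) 17–40
[`Balaban1984PropagatorsI`, "B5"], pp. 36–39 [PDF 20–23]; held as `paper:balaban1984-cmp95-propagators-rt-i` (text layer
p0020–p0023 re-read this session).  Unit `lit-balaban-r02`, HOME `run/shared/lean/pub/lit-balaban/` (SKELETON rows
B5.Prop1.2, B5.Eq1.125, B5.Eq1.130, B5.Eq1.131; owner r02).
v1.1 (docstring-only; declarations byte-identical to v1 p313604): page loci corrected after the B5 second reader՚s pass 20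
note 20-(a) — «we estimate the norm … by the sum of norms» and (1.125) are printed on p. 38 [PDF 22] (the sentence opens on the
last line of p. 37), not on p. 37.

## WHAT IS PRINTED (verbatim)

p. 36 [PDF 20 L20–21]: «A proof of Proposition 1.2 will be given in several steps. In the first step we will show that
the inequalities (1.115)–(1.117), (1.89) imply the proposition.»  p. 38 [PDF 22 L30]: «Gathering together all these
estimates we obtain ‖ζ∇G∇*J‖_α ≤ O(1)(‖ζ‖_α + |ζ|) Σ_{n=0}^∞ O(1)^{2n}M₀^{−n} Σ_{ω: y∈□_{ω₀}, y′∈□_{ω_n}}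
e^{−2δ₀|ω₀−ω₁|}·…·e^{−2δ₀|ω_{n−1}−ω_n|}(‖J‖_{α+ε} + |J|) ≤ … (1.131)».  p. 39 [PDF 23 L2–9]: «Let us notice that the
constant O(1) under the sum above is an absolute constant depending on d only, hence we can fix M₀ depending on d only,
such that the series is convergent. … The proofs of the other inequalities are exactly the same, but in the estimates
of G∇*J we have to take a representation of G adjoint to (1.123), with the operators K(h) acting on the right.»
p. 39 [PDF 23 L10–12]: «Let us notice that the proof of inequalities (1.114), describing the decay in L²-norms, is
completed because we have proved inequalities (1.89).»

## WHAT THIS MODULE PROVES (kernel-checked, zero sorry)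

* `Rep` — ONE REPRESENTATION of the operator data of an instance `St = (k, T_η)` at cube scale `M₀` on a real seminormed
  carrier `V` (model: the sections with the sup norm `|·|` for the direct walk (1.123); the sections with the weighted
  ℓ¹ norm and the same — symmetric — operators for the «representation of G adjoint to (1.123)» of p. 39): `G = Δ_a⁻¹`,
  `Δ_a`, `h_z`, `∇` with (1.118), (1.71), `|h_zA| ≤ |A|`, and the two located printed-shape leaves (1.115) (read on the
  representation: `|GB|, |∇GB| ≤ c_G·O(1)·|B|` from the GLOBAL inequalities of the instance) and (1.126) ⇒ (1.128) (sup
  form, `2δ₀ = min{⅓δ′₀, M₀⁻¹}`); `Rep.model` = the `B5SupWalk125.SupModel` it carries at `γ = c_G·O(1)`,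
  `θ = θ̄(δ′₀, C)/M₀`, `δ₀ = (2M₀)⁻¹`, `c = c̄M₀` (once `M₀ ≥ 3/δ′₀`);
* `DomCert` — the DOMINATION CERTIFICATE of one typed entry: finitely many walk problems, each `B5SupWalk131.Dominated`
  on some representation with ends `u, u′` at distance `≥ |y − y′|` (either direction — the adjoint walk runs from `y` to
  `y′`), below whose common bound the entry lies («we estimate the norm ‖ζ∇G∇*J‖_α by the sum of norms», p. 38; e.g. the
  typed `max(‖ζ∇GJ‖_α, ‖ζG∇*J‖_α)` of (1.111) needs a direct and an adjoint problem);
* `SupRealisation` — the DICTIONARY of one instance at scale `M₀`: representations `rep r` over a shared cube geometry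
  (`ctr`, `hν`, `hrow` — the same fields as b05's L² `B5Local114.Realisation`), and, for EVERY typed entry of
  (1.110)–(1.113) of `B5.Setting`, a `DomCert` GIVEN the (1.115)–(1.117) constants of the family (the envelope `env` of the
  constants is the one of `B5SupWalk131`);
* `bound_of_dominated`, `bound_of_domCert` — one walk problem / one certified entry at the p. 39 choice of `M₀`:
  `q ≤ Const(A)·e^{−(2M₀)⁻¹|y−y′|}·s₁·m₁`;
* **`firstSecondOrder_of_supRealisation`** — (1.115)–(1.117) (`B5.Global115_117Fam`) and (1.126) (`B5.Kernel126_127Printed`)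
  imply the first- and second-order blocks (1.110)–(1.113) of Prop. 1.2 for the family (`B5FromB4.FirstOrderFam ∧
  SecondOrderFam`), constants chosen BEFORE the instance, `M₀ = ⌈max{1, 3/δ′₀, 4γθ̄K̄}⌉` («we can fix M₀ depending on
  d only, such that the series is convergent»);
* **`s1_of_walks`** — THE SLOT `S1 : Global115_117Fam fam g → Prop11Printed fam → Kernel126_127Printed K → Prop12Printed fam`
  of `B5.prop12_of_printed_steps` DISCHARGED for a family carrying a sup/Hölder realisation AND b05's L² realisation at
  every cube scale (the (1.114) block of `Prop12Printed` is the L² walk, p. 39 L10–12, via `B5Local114.local114_of_realisation`;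
  the blocks are merged by `B5FromB4.prop12_of_blocks` under the model signs);
* `prop12_of_printed_steps_via_walks` — `B5.prop12_of_printed_steps` with BOTH walk slots S1′ and S1 supplied: the
  remaining hypotheses are S3 (Prop. 1.2 for `G₀`) and S2 ((1.132) transfer) only.

## HONEST SCOPE / DIVERGENCE

(1) Abstract mechanism only, exactly as `B5Local114` §3 and `B5SupWalk125/131`: no torus operator is constructed here;
(1.115) read on a representation, (1.126) ⇒ (1.128), and the per-entry factor estimates (1.125), (1.129), (1.130) with the
localities «y ∈ □_{ω₀}, y′ ∈ □_{ω_n}» are LOCATED PRINTED-SHAPE LEAVES (fields of `Rep` / `SupRealisation`, GAPS G-B5-24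
style), to be instantiated on the tori of record (the `B5Walk*Torus` line of seat p38 builds the L² one).  (2) The p. 39
adjoint representation is modelled by allowing several representations per instance and letting each typed entry choose
one; nothing forces the model reading (direct = sup carrier, adjoint = ℓ¹ carrier) — that is the instantiation's business.
(3) (1.89) enters S1 only through the (1.114) block (p. 39 L10–12); the sup/Hölder blocks use (1.115)–(1.117) and (1.126)
only, as printed.  (4) Constants ours and explicit; `M₀` depends on the (1.115) constant, on `δ′₀, O(1)` of (1.126) and on
`κ` — all fixed before the instance («depending on d only» in print because those are).  CELL BOOK-KEEPING (lit-balaban):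
rows B5.Prop1.2 (slot S1 of the printed-steps chain discharged modulo located leaves), B5.Eq1.125/1.130/1.131 (printed
currency mechanism, family level) — VALUE = kernel check of the p. 36/p. 39 implication structure, NOT summit progress.
-/

namespace Literature.MathematicalPhysics.QuantumFieldTheory.Balaban1983to89.B5SupWalkS1

open Finset
open Literature.MathematicalPhysics.QuantumFieldTheory.Balaban1983to89
open Literature.MathematicalPhysics.QuantumFieldTheory.Balaban1983to89.B5SupWalk125
open Literature.MathematicalPhysics.QuantumFieldTheory.Balaban1983to89.B5SupWalk131
open Literature.MathematicalPhysics.QuantumFieldTheory.Balaban1983to89.B5Local114 (Kop)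
open Literature.MathematicalPhysics.QuantumFieldTheory.Balaban1983to89.B5Walk131 (twoDelta0 twoDelta0_eq_inv)

noncomputable section

/-! ## §1 The envelope of the (1.115)–(1.117) constants is at least `1` -/

/-- [folklore: `1 + Σ|·| ≥ 1`] -/
private theorem one_le_env (C a e e' ae : ℝ) : 1 ≤ env C a e e' ae := by
  unfold env
  have h1 := abs_nonneg C
  have h2 := abs_nonneg a
  have h3 := abs_nonneg e
  have h4 := abs_nonneg e'
  have h5 := abs_nonneg ae
  linarith

/-- [folklore: `1 + Σ|·| > 0`] -/
private theorem env_pos (C a e e' ae : ℝ) : 0 < env C a e e' ae :=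
  lt_of_lt_of_le one_pos (one_le_env C a e e' ae)

/-! ## §2 One representation of the operator data of an instance, and the `SupModel` it carries -/

section Rep

/-- **ONE REPRESENTATION of the walk data of an instance `St = (k, T_η)` at cube scale `M₀`** on a real seminormed
carrier `V` (model: the lattice sections with the sup norm `|·|` of (1.108) for the direct walk (1.123); the SAME symmetric
operators on the sections with the weighted ℓ¹ norm for p. 39's «representation of G adjoint to (1.123), with the
operators K(h) acting on the right»), relative to the shared cube centres `ctr`:
* operators `G = Δ_a⁻¹` and `Δ_a` with (1.71) p. 30 «Δ_a⁻¹ = G_k, or simply G. (1.71)» (`h71`, `h71'`), the partition of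
  unity `h_z = H z` with (1.118) p. 36 «hence Σ_z h_z²(x) = 1. (1.118)» (`h118`) and `|h_zA| ≤ |A|` (`normH`, `0 ≤ h ≤ 1`),
  the gradient `∇ = Dg` as the size map of (1.128);
* LEAF `h115` — (1.115) p. 36 «|GJ|, |∇GJ|, |G∇*J|, |ΔGJ|, ‖∇GJ‖_α, ‖G∇*J‖_α ≤ O(1)|J|, (1.115)» READ ON THE
  REPRESENTATION: whenever the instance obeys the global inequalities (1.115)–(1.117) with constants `(C, C_α, C_ε,
  C_{α,ε})` (`B5.Global115_117`), the operator bounds `‖GB‖, ‖∇GB‖ ≤ c_G·C·‖B‖` hold on `V` (model: sup norm — the first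
  two members; ℓ¹ norm — by duality from the members `|GJ|`, `|G∇*J|`, `G` symmetric p. 33);
* LEAF `h128` — (1.126) ⇒ (1.128) p. 38 in sup form, verbatim: «Defining 2δ₀ = min{⅓δ′₀, M₀⁻¹}, we obtain
  |h_{z₁}K(h_{z₂})A| ≤ O(M₀⁻¹)e^{−2δ₀|z₁−z₂|}(|∇A| + |A|). (1.128)», with `O(M₀⁻¹) = θ̄(δ′₀, C)/M₀` and
  `2δ₀ = B5Walk131.twoDelta0 δ′₀ M₀`, the (1.126) constants `δ′₀, C` of `B5.Kernel126_127Printed` as input.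
Nothing here is proved in this file: these are the hypotheses of the family theorems below, to be instantiated on the
tori of record. [cite: Balaban1984PropagatorsI, (1.71) p.30, (1.115), (1.118) p.36, (1.123) p.37, (1.128) p.38, p.39] -/
structure Rep (St : B5.Setting) (kd : B5.KernelData) (g : B5.GlobalH St) (M₀ : ℕ) (κ : SupConsts)
    (V Vg : Type) [SeminormedAddCommGroup V] [Module ℝ V] [SeminormedAddCommGroup Vg] [Module ℝ Vg]
    (X : Type) [PseudoMetricSpace X] (S : Type) [Fintype S] (ctr : S → X) : Type where
  /-- `G = Δ_a⁻¹` on this representation. -/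
  G : Module.End ℝ V
  /-- `Δ_a`. -/
  Δa : Module.End ℝ V
  /-- the partition of unity `h_z`, (1.118). -/
  H : S → Module.End ℝ V
  /-- the gradient `∇` as a size map. -/
  Dg : V →ₗ[ℝ] Vg
  /-- (1.118) p. 36: `Σ_z h_z² = 1`. -/
  h118 : ∑ z, H z * H z = 1
  /-- (1.71) p. 30. -/
  h71 : Δa * G = 1
  h71' : G * Δa = 1
  /-- `0 ≤ h ≤ 1`. -/
  normH : ∀ (z : S) (v : V), ‖H z v‖ ≤ ‖v‖
  /-- (1.115) read on the representation. -/
  h115 : ∀ (C : ℝ) (Cα Cε : ℝ → ℝ) (Cαε : ℝ → ℝ → ℝ), 0 < C → B5.Global115_117 St g C Cα Cε Cαε →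
    (∀ B : V, ‖G B‖ ≤ κ.cG * C * ‖B‖) ∧ (∀ B : V, ‖Dg (G B)‖ ≤ κ.cG * C * ‖B‖)
  /-- (1.126) ⇒ (1.128) p. 38, sup form, with `2δ₀ = min{⅓δ′₀, M₀⁻¹}`. -/
  h128 : ∀ δ₀' C' : ℝ, 0 < δ₀' → 0 < C' →
    (∀ x x' : kd.X, |kd.ker x x'| ≤ C' * Real.exp (-(δ₀' * kd.dist x x'))) →
    ∀ (z₁ z₂ : S) (A : V), ‖H z₁ (Kop Δa H z₂ A)‖
      ≤ κ.thetaBar δ₀' C' / M₀ * Real.exp (-(twoDelta0 δ₀' M₀ * dist (ctr z₁) (ctr z₂))) * (‖Dg A‖ + ‖A‖)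

namespace Rep

variable {St : B5.Setting} {kd : B5.KernelData} {g : B5.GlobalH St} {M₀ : ℕ} {κ : SupConsts}
  {V Vg : Type} [SeminormedAddCommGroup V] [Module ℝ V] [SeminormedAddCommGroup Vg] [Module ℝ Vg]
  {X : Type} [PseudoMetricSpace X] {S : Type} [Fintype S] {ctr : S → X}
  (ρ : Rep St kd g M₀ κ V Vg X S ctr)

/-- **The `SupModel` carried by a representation**, at the (1.115)–(1.117) constants `(C, …)` of the family and the
(1.126) constants `δ′₀, C′`, once `M₀ ≥ 3/δ′₀` (so that `2δ₀ = min{⅓δ′₀, M₀⁻¹} = M₀⁻¹`, `B5Walk131.twoDelta0_eq_inv`):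
`γ = c_G·C`, `θ = θ̄(δ′₀,C′)/M₀`, `δ₀ = (2M₀)⁻¹`, `c = c̄M₀` — p. 39: «This M₀ is approximately equal to the norm O(1) in
the inequalities (1.115), (1.128)». [cite: Balaban1984PropagatorsI, p.38 before (1.128), p.39] -/
def model {C : ℝ} {Cα Cε : ℝ → ℝ} {Cαε : ℝ → ℝ → ℝ} (hC : 0 < C)
    (hG : B5.Global115_117 St g C Cα Cε Cαε)
    {δ₀' C' : ℝ} (hδ : 0 < δ₀') (hC' : 0 < C')
    (hker : ∀ x x' : kd.X, |kd.ker x x'| ≤ C' * Real.exp (-(δ₀' * kd.dist x x')))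
    (hM : (0 : ℝ) < M₀) (h3 : 3 / δ₀' ≤ (M₀ : ℝ)) : SupModel V Vg S X where
  G := ρ.G
  Δa := ρ.Δa
  H := ρ.H
  Dg := ρ.Dg
  ctr := ctr
  γ := κ.cG * C
  θ := κ.thetaBar δ₀' C' / M₀
  δ₀ := (2 * (M₀ : ℝ))⁻¹
  c := κ.cbar * M₀
  h118 := ρ.h118
  h71 := ρ.h71
  h71' := ρ.h71'
  normH := ρ.normH
  h115 := (ρ.h115 C Cα Cε Cαε hC hG).1
  h115' := (ρ.h115 C Cα Cε Cαε hC hG).2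
  h128 := by
    intro z₁ z₂ A
    have h := ρ.h128 δ₀' C' hδ hC' hker z₁ z₂ A
    have htwo : twoDelta0 δ₀' (M₀ : ℝ) = 2 * (2 * (M₀ : ℝ))⁻¹ := by
      rw [twoDelta0_eq_inv hM hδ h3]; field_simp
    rw [htwo] at h
    exact h
  γ_pos := mul_pos κ.cG_pos hC
  θ_nonneg := div_nonneg (κ.thetaBar_nonneg δ₀' C') hM.le
  δ₀_nonneg := by positivity

end Rep

end Rep

/-! ## §3 Domination certificates and the sup/Hölder realisation of one instance -/

section Cert

variable {St : B5.Setting} {kd : B5.KernelData} {g : B5.GlobalH St} {M₀ : ℕ} {κ : SupConsts}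
  {R : Type} {V Vg : R → Type} [∀ r, SeminormedAddCommGroup (V r)] [∀ r, Module ℝ (V r)]
  [∀ r, SeminormedAddCommGroup (Vg r)] [∀ r, Module ℝ (Vg r)]
  {X : Type} [PseudoMetricSpace X] {S : Type} [Fintype S]

/-- **DOMINATION CERTIFICATE of one typed entry `q` of (1.110)–(1.113)** with label distance `t = |y − y′|`, envelope
`A` of the (1.115)–(1.117) constants it may use, and sizes `s₁` (cut), `m₁` (source): `q` is below any common bound of
FINITELY MANY walk problems `qs j`, each `B5SupWalk131.Dominated` on some representation `rep r` (p. 39: the direct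
walk (1.123), or «a representation of G adjoint to (1.123), with the operators K(h) acting on the right» for the `G∇*J`
entries — e.g. the typed `max(‖ζ∇GJ‖_α, ‖ζG∇*J‖_α)` of (1.111) needs one of each), with its output functional localised at
a point `u` and its source at a point `u′` at distance `d(u, u′) ≥ |y − y′|` («ω: y ∈ □_{ω₀}, y′ ∈ □_{ω_n}» under the sum
of (1.131), in either direction), and «we estimate the norm ‖ζ∇G∇*J‖_α by the sum of norms» (p. 38 l.1–2; the sentence
opens on the last line of p. 37). [cite: Balaban1984PropagatorsI, (1.123) p.37, (1.129)–(1.131) p.38, p.39] -/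
def DomCert (ctr : S → X) (rep : ∀ r : R, Rep St kd g M₀ κ (V r) (Vg r) X S ctr)
    (A s₁ m₁ t q : ℝ) : Prop :=
  0 ≤ s₁ ∧ 0 ≤ m₁ ∧
  ∃ (n : ℕ) (qs : Fin n → ℝ),
    (∀ j : Fin n, ∃ (r : R) (u u' : X) (src : V r), t ≤ dist u u' ∧
      Dominated (rep r).G (rep r).H (rep r).Dg ctr (κ.cbar * M₀) κ A s₁ m₁ u u' src (qs j)) ∧
    (∀ B : ℝ, 0 ≤ B → (∀ j : Fin n, qs j ≤ B) → q ≤ B)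

end Cert

/-- **A SUP/HÖLDER REALISATION of one instance `St = (k, T_η)` of `B5.Setting` at cube scale `M₀`** — the dictionary
between the abstract carrier of `B5.lean` and the sup-currency walk machine of `B5SupWalk125`/`B5SupWalk131`, every
non-derived input a LOCATED PRINTED-SHAPE LEAF:
* shared cube geometry at scale `M₀` (p. 36, verbatim: «cubes □_z of size 2M₀ and with a center at the point
  z ∈ T^{(k+m₀)}_{M₀} … These cubes cover the lattice T_η»): the centres `ctr : S → X`, `hν` (a point of `X` is within
  `c̄M₀` of at most `ν` centres) and `hrow` (the row sum `Σ_{z′} e^{−|z−z′|/(2M₀)} ≤ K̄` = the printed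
  `Σ_{x∈Z^d} e^{−δ₀M₀|x|}` of (1.131) with `δ₀M₀ = ½`) — the SAME fields as the L² `B5Local114.Realisation`, so one torus
  geometry serves both walks;
* a family of representations `rep r`, `r : R` (`Rep`: operators + the leaves (1.115), (1.126) ⇒ (1.128) on the carrier
  `V r`) — p. 39: the direct walk (1.123) and the adjoint one for the `G∇*J` entries;
* per typed entry of (1.110)–(1.113) — `St.e n J y` (the four sup entries), `St.h1 J α ζ` (1.111), `St.e4 J y` (1.112),
  `St.h2 J α ζ` (1.113) — GIVEN the (1.115)–(1.117) constants `(C, C_α, C_ε, C_{α,ε})` of the instance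
  (`B5.Global115_117`): a `DomCert` — finitely many walk problems, each with a source localised at one end («supp J ⊂
  Δ̃(y′)») obeying the last-factor estimate (1.129) p. 38 «|∇Gh_z∇*J| + |Gh_z∇*J| ≤ O(1)(‖J‖_ε + |J|) ≤ O(1)(‖J‖_{α+ε} +
  |J|). (1.129)», and dominated through the ADMISSIBLE output functionals localised at the other end (those obeying the
  first-factor estimate (1.125) p. 38 «‖ζ∇h_zGh_zA‖_α ≤ O(1)(‖ζ‖_α + |ζ|)|h_zA|» and the one-factor estimate (1.130) p. 38
  «‖ζ∇h_zGh_z∇*J‖_α ≤ O(1)(‖ζ‖_α + |ζ|)(‖J‖_{α+ε} + |J|)»), with the sizes `s₁` (cut: `1` or `‖ζ‖_α + |ζ|`) and `m₁` (source: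
  `|J|`, `‖J‖_ε + |J|`, `‖J‖_{α+ε} + |J|`) of the printed right sides and the envelope `A = env …` (`B5SupWalk131.env`) of
  the constants the entry may use ((1.110): `C`; (1.111): `C, C_α(α)`; (1.112): `C, C_ε(ε)`; (1.113): `C, C_α(α), C_ε(ε),
  C_ε(α+ε), C_{α,ε}(α,ε)` — «with the constant O(1) depending on d only … on d and α … on d and ε … on d, α and ε»,
  pp. 35–36).
Nothing in this structure is proved in this file: it is the hypothesis of `firstSecondOrder_of_supRealisation`, to be
instantiated on the concrete torus model. [cite: Balaban1984PropagatorsI, pp.36–39, (1.110)–(1.113) pp.35–36, (1.125), (1.129)–(1.131) p.38] -/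
structure SupRealisation (St : B5.Setting) (kd : B5.KernelData) (g : B5.GlobalH St) (M₀ : ℕ) (κ : SupConsts)
    (R : Type) (V Vg : R → Type) [∀ r, SeminormedAddCommGroup (V r)] [∀ r, Module ℝ (V r)]
    [∀ r, SeminormedAddCommGroup (Vg r)] [∀ r, Module ℝ (Vg r)]
    (X : Type) [PseudoMetricSpace X] (S : Type) [Fintype S] : Type where
  /-- cube centres `z ∈ T^{(k+m₀)}_{M₀}` in `X`. -/
  ctr : S → X
  /-- the representations (direct / adjoint …). -/
  rep : ∀ r : R, Rep St kd g M₀ κ (V r) (Vg r) X S ctr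
  /-- geometry of the cube cover at scale `M₀` (p. 36) and the row sum of (1.131). -/
  hν : ∀ x : X, ((Finset.univ.filter fun z : S => dist x (ctr z) ≤ κ.cbar * M₀).card : ℝ) ≤ κ.nu
  hrow : ∀ a : S, ∑ b : S, Real.exp (-((2 * (M₀ : ℝ))⁻¹ * dist (ctr a) (ctr b))) ≤ κ.Kbar
  /-- (1.110): the four sup entries, envelope `env C 0 0 0 0`, sizes `1`, `|J|`. -/
  certSup : ∀ (C : ℝ) (Cα Cε : ℝ → ℝ) (Cαε : ℝ → ℝ → ℝ), 0 < C → B5.Global115_117 St g C Cα Cε Cαε →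
    ∀ (n : Fin 4) (J : St.Loc) (y y' : St.Site), St.suppIn J y' →
      DomCert ctr rep (env C 0 0 0 0) 1 (St.supNorm J) (St.dist y y') (St.e n J y)
  /-- (1.111): `max(‖ζ∇GJ‖_α, ‖ζG∇*J‖_α)`, envelope `env C (C_α α) 0 0 0`, sizes `‖ζ‖_α + |ζ|`, `|J|`. -/
  certH1 : ∀ (C : ℝ) (Cα Cε : ℝ → ℝ) (Cαε : ℝ → ℝ → ℝ), 0 < C → B5.Global115_117 St g C Cα Cε Cαε →
    ∀ (α : ℝ) (J : St.Loc) (ζ : St.Cut) (y y' : St.Site), 0 ≤ α → α < 1 → St.cutIn ζ y → St.suppIn J y' →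
      DomCert ctr rep (env C (Cα α) 0 0 0) (St.cutH α ζ) (St.supNorm J) (St.dist y y') (St.h1 J α ζ)
  /-- (1.112): `sup |(∇G∇*J)(x)|`, envelope `env C 0 (C_ε ε) 0 0`, sizes `1`, `‖J‖_ε + |J|`. -/
  certE4 : ∀ (C : ℝ) (Cα Cε : ℝ → ℝ) (Cαε : ℝ → ℝ → ℝ), 0 < C → B5.Global115_117 St g C Cα Cε Cαε →
    ∀ (ε : ℝ) (J : St.Loc) (y y' : St.Site), 0 < ε → ε < 1 → St.suppIn J y' →
      DomCert ctr rep (env C 0 (Cε ε) 0 0) 1 (St.holder ε J + St.supNorm J) (St.dist y y') (St.e4 J y)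
  /-- (1.113): `‖ζ∇G∇*J‖_α`, envelope `env C (C_α α) (C_ε ε) (C_ε (α+ε)) (C_{α,ε} α ε)`, sizes `‖ζ‖_α + |ζ|`,
  `‖J‖_{α+ε} + |J|`. -/
  certH2 : ∀ (C : ℝ) (Cα Cε : ℝ → ℝ) (Cαε : ℝ → ℝ → ℝ), 0 < C → B5.Global115_117 St g C Cα Cε Cαε →
    ∀ (α ε : ℝ) (J : St.Loc) (ζ : St.Cut) (y y' : St.Site), 0 ≤ α → 0 < ε → α + ε < 1 →
      St.cutIn ζ y → St.suppIn J y' →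
      DomCert ctr rep (env C (Cα α) (Cε ε) (Cε (α + ε)) (Cαε α ε)) (St.cutH α ζ)
        (St.holder (α + ε) J + St.supNorm J) (St.dist y y') (St.h2 J α ζ)

/-! ## §4 One entry at the p. 39 choice of `M₀` -/

/-- The final `O(1)` of one entry as a function of the envelope `A` of the (1.115)–(1.117) constants it uses:
`Const κ M₀ γ A = (c₁A + c_F A·c_L A/(2γ))·ν·e^{2(2M₀)⁻¹·c̄M₀}·2 + 1` (the walk bound of `B5SupWalk131.dominated_le` with
`(1 − 2γθK̄)⁻¹ ≤ 2`, plus `1` for positivity). [cite: Balaban1984PropagatorsI, (1.131) p.38, p.39] -/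
def Const (κ : SupConsts) (M₀ : ℕ) (γ A : ℝ) : ℝ :=
  (κ.c1 * A + κ.cF * A * (κ.cL * A) / (2 * γ)) * κ.nu * Real.exp (2 * (2 * (M₀ : ℝ))⁻¹ * (κ.cbar * M₀)) * 2 + 1

/-- [folklore: positivity of the final constant] -/
private theorem Const_pos (κ : SupConsts) (M₀ : ℕ) {γ A : ℝ} (hγ : 0 < γ) (hA : 0 ≤ A) : 0 < Const κ M₀ γ A := by
  unfold Const
  have := κ.c1_nonneg; have := κ.cF_nonneg; have := κ.cL_nonneg; have := κ.nu_nonneg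
  positivity

section OneEntry

variable {St : B5.Setting} {kd : B5.KernelData} {g : B5.GlobalH St} {M₀ : ℕ} {κ : SupConsts}
  {R : Type} {V Vg : R → Type} [∀ r, SeminormedAddCommGroup (V r)] [∀ r, Module ℝ (V r)]
  [∀ r, SeminormedAddCommGroup (Vg r)] [∀ r, Module ℝ (Vg r)]
  {X : Type} [PseudoMetricSpace X] {S : Type} [Fintype S]

/-- **ONE DOMINATED WALK PROBLEM AT THE p. 39 SCALE `M₀`.**  If `M₀ ≥ max{1, 3/δ′₀, 4γθ̄K̄}` (`γ = c_G·C` the (1.115)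
constant read on the representations, `θ̄ = θ̄(δ′₀, C′)` the `M₀·O(M₀⁻¹)` of (1.128), `K̄` the row sum of (1.131)) — so that
the ratio `2γθK̄` of the walk series is `≤ ½`, p. 39 «we can fix M₀ depending on d only, such that the series is
convergent» — then a quantity `q` dominated on the representation `r` with envelope `A ≥ 0`, sizes `s₁, m₁` and ends
`u, u′` with `t ≤ d(u, u′)` obeys `q ≤ Const(A)·e^{−(2M₀)⁻¹t}·s₁·m₁`, by `B5SupWalk131.dominated_le` ((1.131)) on the
`SupModel` of `rep r`. [cite: Balaban1984PropagatorsI, (1.131) p.38, p.39] -/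
theorem bound_of_dominated (ρ : SupRealisation St kd g M₀ κ R V Vg X S)
    {C : ℝ} {Cα Cε : ℝ → ℝ} {Cαε : ℝ → ℝ → ℝ} (hC : 0 < C) (hG : B5.Global115_117 St g C Cα Cε Cαε)
    {δ₀' C' : ℝ} (hδ : 0 < δ₀') (hC' : 0 < C')
    (hker : ∀ x x' : kd.X, |kd.ker x x'| ≤ C' * Real.exp (-(δ₀' * kd.dist x x')))
    (hM1 : (1 : ℝ) ≤ M₀) (h3 : 3 / δ₀' ≤ (M₀ : ℝ))
    (h4 : 4 * (κ.cG * C) * κ.thetaBar δ₀' C' * κ.Kbar ≤ (M₀ : ℝ))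
    {A s₁ m₁ t : ℝ} (hA : 0 ≤ A) {u u' : X} (ht : t ≤ dist u u') {q : ℝ} (r : R) (src : V r)
    (hdom : Dominated (ρ.rep r).G (ρ.rep r).H (ρ.rep r).Dg ρ.ctr (κ.cbar * M₀) κ A s₁ m₁ u u' src q) :
    q ≤ Const κ M₀ (κ.cG * C) A * Real.exp (-((2 * (M₀ : ℝ))⁻¹ * t)) * s₁ * m₁ := by
  have hM0 : (0 : ℝ) < M₀ := by linarith
  set γ : ℝ := κ.cG * C with hγdef
  have hγ : 0 < γ := mul_pos κ.cG_pos hC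
  have hθb := κ.thetaBar_nonneg δ₀' C'
  have hKb := κ.Kbar_nonneg
  have hδ₀ : (0 : ℝ) < (2 * (M₀ : ℝ))⁻¹ := by positivity
  -- the `SupModel` of the representation `r`
  let M : SupModel (V r) (Vg r) S X := (ρ.rep r).model hC hG hδ hC' hker hM0 h3
  -- the ratio of the geometric series is ≤ ½
  have hq : 2 * γ * (κ.thetaBar δ₀' C' / M₀) * κ.Kbar ≤ 1 / 2 := by
    have e : 2 * γ * (κ.thetaBar δ₀' C' / (M₀ : ℝ)) * κ.Kbar = (2 * γ * κ.thetaBar δ₀' C' * κ.Kbar) / M₀ := by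
      ring
    rw [e, div_le_iff₀ hM0]
    linarith
  have hsmall : 2 * γ * (κ.thetaBar δ₀' C' / M₀) * κ.Kbar < 1 := by linarith
  have hinv : (1 - 2 * γ * (κ.thetaBar δ₀' C' / M₀) * κ.Kbar)⁻¹ ≤ 2 := by
    have h12 : (1 : ℝ) / 2 ≤ 1 - 2 * γ * (κ.thetaBar δ₀' C' / M₀) * κ.Kbar := by linarith
    have := one_div_le_one_div_of_le (by norm_num : (0 : ℝ) < 1 / 2) h12
    rw [inv_eq_one_div]
    linarith [show (1 : ℝ) / (1 / 2) = 2 by norm_num]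
  have hinv0 : 0 ≤ (1 - 2 * γ * (κ.thetaBar δ₀' C' / M₀) * κ.Kbar)⁻¹ := inv_nonneg.mpr (by linarith)
  -- sizes are nonnegative (part of the certificate)
  have hs₁ : 0 ≤ s₁ := hdom.1
  have hm₁ : 0 ≤ m₁ := hdom.2.1
  -- (1.131) for the dominated quantity
  have key := dominated_le M (κ := κ) (K := κ.Kbar) (ν := κ.nu) hKb ρ.hrow ρ.hν hsmall hA hdom
  -- the label distance is at most the distance of the ends
  have hexp : Real.exp (-((2 * (M₀ : ℝ))⁻¹ * dist u u')) ≤ Real.exp (-((2 * (M₀ : ℝ))⁻¹ * t)) :=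
    Real.exp_le_exp.mpr (neg_le_neg (mul_le_mul_of_nonneg_left ht hδ₀.le))
  have hc1 := κ.c1_nonneg; have hcF := κ.cF_nonneg; have hcL := κ.cL_nonneg; have hν := κ.nu_nonneg
  have hB0 : 0 ≤ (κ.c1 * A + κ.cF * A * (κ.cL * A) / (2 * γ)) * κ.nu
      * Real.exp (2 * (2 * (M₀ : ℝ))⁻¹ * (κ.cbar * M₀)) := by positivity
  have hCfin0 : 0 ≤ Const κ M₀ γ A := (Const_pos κ M₀ hγ hA).le
  calc q ≤ (κ.c1 * A + κ.cF * A * (κ.cL * A) / (2 * γ)) * κ.nu * Real.exp (2 * (2 * (M₀ : ℝ))⁻¹ * (κ.cbar * M₀))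
          * (1 - 2 * γ * (κ.thetaBar δ₀' C' / M₀) * κ.Kbar)⁻¹
          * Real.exp (-((2 * (M₀ : ℝ))⁻¹ * dist u u')) * (s₁ * m₁) := key
    _ ≤ (κ.c1 * A + κ.cF * A * (κ.cL * A) / (2 * γ)) * κ.nu * Real.exp (2 * (2 * (M₀ : ℝ))⁻¹ * (κ.cbar * M₀))
          * 2 * Real.exp (-((2 * (M₀ : ℝ))⁻¹ * t)) * (s₁ * m₁) := by
        have hsm : 0 ≤ s₁ * m₁ := mul_nonneg hs₁ hm₁
        gcongr
    _ ≤ Const κ M₀ γ A * Real.exp (-((2 * (M₀ : ℝ))⁻¹ * t)) * (s₁ * m₁) := by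
        have hsm : 0 ≤ s₁ * m₁ := mul_nonneg hs₁ hm₁
        have hle : (κ.c1 * A + κ.cF * A * (κ.cL * A) / (2 * γ)) * κ.nu
            * Real.exp (2 * (2 * (M₀ : ℝ))⁻¹ * (κ.cbar * M₀)) * 2 ≤ Const κ M₀ γ A := by
          unfold Const; linarith
        gcongr
    _ = Const κ M₀ (κ.cG * C) A * Real.exp (-((2 * (M₀ : ℝ))⁻¹ * t)) * s₁ * m₁ := by
        rw [hγdef]; ring

/-- **ONE CERTIFIED ENTRY AT THE p. 39 SCALE `M₀`**: a typed entry `q` with a `DomCert` (label distance `t = |y − y′|`,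
envelope `A ≥ 0`, sizes `s₁, m₁`) obeys `q ≤ Const(A)·e^{−(2M₀)⁻¹|y−y′|}·s₁·m₁` — each of its finitely many walk problems is
bounded by `bound_of_dominated`, and the entry is below their common bound («by the sum of norms», p. 38).
[cite: Balaban1984PropagatorsI, (1.131) p.38, p.39] -/
theorem bound_of_domCert (ρ : SupRealisation St kd g M₀ κ R V Vg X S)
    {C : ℝ} {Cα Cε : ℝ → ℝ} {Cαε : ℝ → ℝ → ℝ} (hC : 0 < C) (hG : B5.Global115_117 St g C Cα Cε Cαε)
    {δ₀' C' : ℝ} (hδ : 0 < δ₀') (hC' : 0 < C')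
    (hker : ∀ x x' : kd.X, |kd.ker x x'| ≤ C' * Real.exp (-(δ₀' * kd.dist x x')))
    (hM1 : (1 : ℝ) ≤ M₀) (h3 : 3 / δ₀' ≤ (M₀ : ℝ))
    (h4 : 4 * (κ.cG * C) * κ.thetaBar δ₀' C' * κ.Kbar ≤ (M₀ : ℝ))
    {A s₁ m₁ t q : ℝ} (hA : 0 ≤ A) (hcert : DomCert ρ.ctr ρ.rep A s₁ m₁ t q) :
    q ≤ Const κ M₀ (κ.cG * C) A * Real.exp (-((2 * (M₀ : ℝ))⁻¹ * t)) * s₁ * m₁ := by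
  obtain ⟨hs₁, hm₁, n, qs, hqs, hdict⟩ := hcert
  have hγ : 0 < κ.cG * C := mul_pos κ.cG_pos hC
  have hB0 : 0 ≤ Const κ M₀ (κ.cG * C) A * Real.exp (-((2 * (M₀ : ℝ))⁻¹ * t)) * s₁ * m₁ := by
    have := (Const_pos κ M₀ hγ hA).le
    positivity
  refine hdict _ hB0 fun j => ?_
  obtain ⟨r, u, u', src, ht, hdom⟩ := hqs j
  exact bound_of_dominated ρ hC hG hδ hC' hker hM1 h3 h4 hA ht r src hdom

end OneEntry

/-! ## §5 The family theorems: (1.110)–(1.113) from (1.115)–(1.117) + (1.126), and the slot S1 -/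

section Family

variable {I : Type}

/-- **(1.115)–(1.117) + (1.126) ⇒ THE FIRST- AND SECOND-ORDER BLOCKS (1.110)–(1.113) OF PROPOSITION 1.2**, p. 36,
verbatim: «In the first step we will show that the inequalities (1.115)–(1.117), (1.89) imply the proposition.» — for a
family of instances each carrying a sup/Hölder realisation at every cube scale `M₀ ≥ 1` with uniform constants `κ`
(`SupRealisation`: located printed leaves + per-entry domination certificates; the carriers may depend on the instance,
on `M₀` and on the representation), the global inequalities (1.115)–(1.117) with constants chosen before the instance
(`B5.Global115_117Fam`) and the printed kernel bounds (1.126)–(1.127) (`B5.Kernel126_127Printed`, its clause (1.126))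
imply the four sup entries (1.110), the Hölder entries (1.111), (1.112) and (1.113) with `δ₀` and the `O(1)`'s chosen
BEFORE the instance (`B5FromB4.FirstOrderFam ∧ SecondOrderFam`).  KERNEL-CHECKED HERE: the choice «M₀ depending on d
only such that the series is convergent» (p. 39: `M₀ = ⌈max{1, 3/δ′₀, 4γθ̄K̄}⌉`, `γ = c_G·C`), the walk estimate (1.131) per
walk problem (`B5SupWalk125.SupModel.entry_bound` through `B5SupWalk131.dominated_le`), and the bookkeeping of the
constants: `δ₀ = (2M₀)⁻¹`, `O(1) = Const(env C 0 0 0 0)`, `O(1)(α) = Const(env C (C_α α) 0 0 0)`, `O(1)(ε) =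
Const(env C 0 (C_ε ε) 0 0)`, `O(1)(α,ε) = Const(env C (C_α α) (C_ε ε) (C_ε(α+ε)) (C_{α,ε} α ε))` («with the constant O(1)
depending on d and α … on d and ε … on d, α and ε», pp. 35–36). [cite: Balaban1984PropagatorsI, p.36, p.39, (1.110)–(1.113) pp.35–36, (1.131) p.38, (1.126) p.38] -/
theorem firstSecondOrder_of_supRealisation (fam : I → B5.Setting) (g : ∀ i, B5.GlobalH (fam i))
    (Kd : I → B5.KernelData) (κ : SupConsts)
    {R : I → ℕ → Type} {V Vg : ∀ i M, R i M → Type}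
    [∀ i M r, SeminormedAddCommGroup (V i M r)] [∀ i M r, Module ℝ (V i M r)]
    [∀ i M r, SeminormedAddCommGroup (Vg i M r)] [∀ i M r, Module ℝ (Vg i M r)]
    {X : I → ℕ → Type} [∀ i M, PseudoMetricSpace (X i M)] {S : I → ℕ → Type} [∀ i M, Fintype (S i M)]
    (real : ∀ (i : I) (M₀ : ℕ), 1 ≤ M₀ →
      SupRealisation (fam i) (Kd i) (g i) M₀ κ (R i M₀) (V i M₀) (Vg i M₀) (X i M₀) (S i M₀)) :
    B5.Global115_117Fam fam g → B5.Kernel126_127Printed Kd →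
      B5FromB4.FirstOrderFam fam ∧ B5FromB4.SecondOrderFam fam := by
  intro hGl hleaf
  obtain ⟨C, Cα, Cε, Cαε, hC, hG⟩ := hGl
  obtain ⟨δ₀', C', Cα', hδ₀', hC', hker⟩ := hleaf
  -- the choice of M₀ "depending on d only" (p. 39)
  obtain ⟨M₀, hM1r, h3, h4⟩ : ∃ M₀ : ℕ, (1 : ℝ) ≤ M₀ ∧ 3 / δ₀' ≤ (M₀ : ℝ) ∧
      4 * (κ.cG * C) * κ.thetaBar δ₀' C' * κ.Kbar ≤ (M₀ : ℝ) := by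
    refine ⟨⌈max 1 (max (3 / δ₀') (4 * (κ.cG * C) * κ.thetaBar δ₀' C' * κ.Kbar))⌉₊, ?_, ?_, ?_⟩
    · exact le_trans (le_max_left _ _) (Nat.le_ceil _)
    · exact le_trans (le_trans (le_max_left _ _) (le_max_right _ _)) (Nat.le_ceil _)
    · exact le_trans (le_trans (le_max_right _ _) (le_max_right _ _)) (Nat.le_ceil _)
  have hM1 : 1 ≤ M₀ := by exact_mod_cast hM1r
  have hγ : 0 < κ.cG * C := mul_pos κ.cG_pos hC
  have hδ₀ : (0 : ℝ) < (2 * (M₀ : ℝ))⁻¹ := by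
    have : (0 : ℝ) < M₀ := by linarith
    positivity
  -- the bound of one certified entry of the instance `i` at this `M₀`
  have main : ∀ (i : I) {A s₁ m₁ t q : ℝ}, 0 ≤ A →
      DomCert (real i M₀ hM1).ctr (real i M₀ hM1).rep A s₁ m₁ t q →
      q ≤ Const κ M₀ (κ.cG * C) A * Real.exp (-((2 * (M₀ : ℝ))⁻¹ * t)) * s₁ * m₁ :=
    fun i A s₁ m₁ t q hA hcert =>
      bound_of_domCert (real i M₀ hM1) hC (hG i) hδ₀' hC' (hker i).1 hM1r h3 h4 hA hcert
  refine ⟨⟨(2 * (M₀ : ℝ))⁻¹, Const κ M₀ (κ.cG * C) (env C 0 0 0 0),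
      fun α => Const κ M₀ (κ.cG * C) (env C (Cα α) 0 0 0), hδ₀,
      Const_pos κ M₀ hγ (env_pos _ _ _ _ _).le, fun i => ⟨?_, ?_⟩⟩,
    ⟨(2 * (M₀ : ℝ))⁻¹, fun ε => Const κ M₀ (κ.cG * C) (env C 0 (Cε ε) 0 0),
      fun α ε => Const κ M₀ (κ.cG * C) (env C (Cα α) (Cε ε) (Cε (α + ε)) (Cαε α ε)), hδ₀,
      fun i => ⟨?_, ?_⟩⟩⟩
  · -- (1.110), the four sup entries
    intro n J y y' hJ
    have h := main i (env_pos C 0 0 0 0).le ((real i M₀ hM1).certSup C Cα Cε Cαε hC (hG i) n J y y' hJ)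
    simpa only [mul_one] using h
  · -- (1.111)
    intro α J ζ y y' hα0 hα1 hζ hJ
    exact main i (env_pos _ _ _ _ _).le
      ((real i M₀ hM1).certH1 C Cα Cε Cαε hC (hG i) α J ζ y y' hα0 hα1 hζ hJ)
  · -- (1.112)
    intro ε J y y' hε0 hε1 hJ
    have h := main i (env_pos _ _ _ _ _).le
      ((real i M₀ hM1).certE4 C Cα Cε Cαε hC (hG i) ε J y y' hε0 hε1 hJ)
    simpa only [mul_one] using h
  · -- (1.113)
    intro α ε J ζ y y' hα0 hε0 hαε hζ hJ
    exact main i (env_pos _ _ _ _ _).le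
      ((real i M₀ hM1).certH2 C Cα Cε Cαε hC (hG i) α ε J ζ y y' hα0 hε0 hαε hζ hJ)

/-- **DISCHARGE OF THE SLOT `S1` OF `B5.prop12_of_printed_steps`** — p. 36 [PDF 20], verbatim: «In the first step we
will show that the inequalities (1.115)–(1.117), (1.89) imply the proposition.»  For a family of instances carrying, at
every cube scale `M₀ ≥ 1`, a sup/Hölder realisation (`SupRealisation`, uniform constants `κ`) AND b05's L² realisation
(`B5Local114.Realisation`, uniform constants `κL`), with the model signs of the norms (`B5FromB4.ModelSigns`): the global
inequalities (1.115)–(1.117) (`B5.Global115_117Fam`), Proposition 1.1 (`B5.Prop11Printed`, clause (1.89)) and the kernel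
bounds (1.126)–(1.127) (`B5.Kernel126_127Printed`) imply Proposition 1.2 (`B5.Prop12Printed`) — the blocks (1.110)–(1.113)
by `firstSecondOrder_of_supRealisation`, the block (1.114) by the L² walk (p. 39 L10–12 «the proof of inequalities (1.114),
describing the decay in L²-norms, is completed because we have proved inequalities (1.89)»,
`B5Local114.local114_of_realisation`), merged into the typed Proposition (one `δ₀` = min, `O(1)`'s = max) by
`B5FromB4.prop12_of_blocks`.  This term has exactly the type of the hypothesis `S1` of `B5.prop12_of_printed_steps`.
[cite: Balaban1984PropagatorsI, p.36, p.39, Prop. 1.2 (1.110)–(1.114) pp.35–36] -/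
theorem s1_of_walks (fam : I → B5.Setting) (g : ∀ i, B5.GlobalH (fam i)) (Kd : I → B5.KernelData)
    (κL : B5Local114.Consts) (κ : SupConsts)
    {VL : I → ℕ → Type} [∀ i M, NormedAddCommGroup (VL i M)] [∀ i M, InnerProductSpace ℝ (VL i M)]
    {XL : I → ℕ → Type} [∀ i M, PseudoMetricSpace (XL i M)] {SL : I → ℕ → Type} [∀ i M, Fintype (SL i M)]
    (realL : ∀ (i : I) (M₀ : ℕ), 1 ≤ M₀ →
      B5Local114.Realisation (fam i) (Kd i) M₀ κL (VL i M₀) (XL i M₀) (SL i M₀))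
    {R : I → ℕ → Type} {V Vg : ∀ i M, R i M → Type}
    [∀ i M r, SeminormedAddCommGroup (V i M r)] [∀ i M r, Module ℝ (V i M r)]
    [∀ i M r, SeminormedAddCommGroup (Vg i M r)] [∀ i M r, Module ℝ (Vg i M r)]
    {X : I → ℕ → Type} [∀ i M, PseudoMetricSpace (X i M)] {S : I → ℕ → Type} [∀ i M, Fintype (S i M)]
    (real : ∀ (i : I) (M₀ : ℕ), 1 ≤ M₀ →
      SupRealisation (fam i) (Kd i) (g i) M₀ κ (R i M₀) (V i M₀) (Vg i M₀) (X i M₀) (S i M₀))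
    (Sg : ∀ i, B5FromB4.ModelSigns (fam i)) :
    B5.Global115_117Fam fam g → B5.Prop11Printed fam → B5.Kernel126_127Printed Kd → B5.Prop12Printed fam := by
  intro hGl h11 hleaf
  have h12 := firstSecondOrder_of_supRealisation fam g Kd κ real hGl hleaf
  exact B5FromB4.prop12_of_blocks fam Sg h12.1 h12.2
    (B5Local114.local114_of_realisation fam Kd κL realL h11 hleaf)

/-- **Corollary: Proposition 1.2 from its printed steps WITH BOTH WALK SLOTS SUPPLIED** — `B5.prop12_of_printed_steps`
with `S1′` (the L² walk, `B5Local114.local114_of_realisation`) and `S1` (`s1_of_walks`) discharged for a family carrying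
the two realisations at every cube scale; the remaining hypotheses are S3 (Proposition 1.2 for `G₀`, pp. 39–40) and S2
(the (1.132) transfer, p. 39) exactly as in `B5.prop12_of_printed_steps`. [cite: Balaban1984PropagatorsI, Prop. 1.2 pp.35–40] -/
theorem prop12_of_printed_steps_via_walks (fam famG0 : I → B5.Setting) (g : ∀ i, B5.GlobalH (fam i))
    (Kd : I → B5.KernelData) (κL : B5Local114.Consts) (κ : SupConsts)
    {VL : I → ℕ → Type} [∀ i M, NormedAddCommGroup (VL i M)] [∀ i M, InnerProductSpace ℝ (VL i M)]
    {XL : I → ℕ → Type} [∀ i M, PseudoMetricSpace (XL i M)] {SL : I → ℕ → Type} [∀ i M, Fintype (SL i M)]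
    (realL : ∀ (i : I) (M₀ : ℕ), 1 ≤ M₀ →
      B5Local114.Realisation (fam i) (Kd i) M₀ κL (VL i M₀) (XL i M₀) (SL i M₀))
    {R : I → ℕ → Type} {V Vg : ∀ i M, R i M → Type}
    [∀ i M r, SeminormedAddCommGroup (V i M r)] [∀ i M r, Module ℝ (V i M r)]
    [∀ i M r, SeminormedAddCommGroup (Vg i M r)] [∀ i M r, Module ℝ (Vg i M r)]
    {X : I → ℕ → Type} [∀ i M, PseudoMetricSpace (X i M)] {S : I → ℕ → Type} [∀ i M, Fintype (S i M)]
    (real : ∀ (i : I) (M₀ : ℕ), 1 ≤ M₀ →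
      SupRealisation (fam i) (Kd i) (g i) M₀ κ (R i M₀) (V i M₀) (Vg i M₀) (X i M₀) (S i M₀))
    (Sg : ∀ i, B5FromB4.ModelSigns (fam i))
    (h11 : B5.Prop11Printed fam) (hleaf : B5.Kernel126_127Printed Kd)
    (S3 : B5.Prop12Printed famG0)
    (S2 : B5.Prop12Printed famG0 → B5.Kernel126_127Printed Kd → B5.Local114Fam fam →
      B5.Global115_117Fam fam g) :
    B5.Prop12Printed fam :=
  B5.prop12_of_printed_steps fam famG0 g Kd h11 hleaf
    (B5Local114.local114_of_realisation fam Kd κL realL) S3 S2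
    (s1_of_walks fam g Kd κL κ realL real Sg)

end Family

end

end Literature.MathematicalPhysics.QuantumFieldTheory.Balaban1983to89.B5SupWalkS1
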